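/-
Origin: expansion seat `prover-pub-hodgecm-own-htheta-0`, handover #H1 2026-08-21T04:2xZ md5 5d05e62a6b9b (223 l.; NEW additive leaf; imports HodgeCM.Model.LiuIndexTwistTypeOfV (#S19) ONLY; ns HodgeCM.Model.LiuIndex; 1 def (`LiuIndex.muLiu`, integer table = Liu's weight-one central type: 0 off w(ι₁), −1∕+1 at w(ι₁) as ι₁ ∈ Φ^δ(q) or not) + 1 abbrev (`placeIndicator`) + 10 theorems; NAMES for audit: HodgeCM.Model.LiuIndex.muLiu · HodgeCM.Model.LiuIndex.muLiu_mk · HodgeCM.Model.LiuIndex.muLiu_mk_eq_add_of_CC · HodgeCM.Model.LiuIndex.I.exists_line_eq_twistBy_bigCharOfV_muLiu) (`HOME/pub-hodgecm-own-htheta/stage72/HodgeCM/Model/LiuIndexMuLiu.lean`, md5 5d05e62a6b9b, 223 lines);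
landed by the second packager p2 gen 18 (p2-g18) in gate run 72 as `HodgeCM/Model/LiuIndexMuLiu.lean` (verbatim).
-/
/-
Copyright (c) 2026 the pub-hodgecm formalisation cell (harness21).  New file, not vendored.
Origin: ROW-9 OWNER seat `prover-pub-hodgecm-own-htheta-0` (unit pub-hodgecm-own-htheta, named single owner of binder row 9 `hΘ`),
2026-08-21.  Target in PKG: `HodgeCM/Model/LiuIndexMuLiu.lean` (NEW additive KERNEL leaf beside E; imports theta-3's #S19
`HodgeCM.Model.LiuIndexTwistTypeOfV` (RUN 71) only; nothing imports it; outside E's import closure; E untouched; MODEL-N: the ONE new `def`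
`LiuIndex.muLiu` is the VALUE of «ATqI»'s recipe binder `μ₀` — the TEXT of MODEL-N COND row N-i1-match is its docstring, the row counts where
the junction child consumes it).  KERNEL: 1 `def` (an integer table) + theorems; 0 records, nothing cited as a fact, 0 `def … : Prop`.
Nothing here is a claim of the manuscripts under adjudication.
-/
import Summits.HodgeConjecture.HodgeCM.Model.LiuIndexTwistTypeOfV

set_option autoImplicit false

/-!
# (J3 ∕ J-μ) THE RECIPE OF RECORD `LiuIndex.muLiu` — Liu's weight-one central type, class by class

The pinned dictionary `liuDictionaryPin … V (LiuIndex.I V ρ μ₀) (LiuIndex.line V ρ μ₀)` is indexed by an integer RECIPE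
`μ₀ : GramClass L → (InfinitePlace L → ℤ)`: over the Gram class `q` it lists the compatible pair splittings `s` whose archimedean CENTRAL
TYPE on the Gaussian of `(V, ⟨q⟩)` is `μ₀ q` (#S15 r2 `LiuIndex.IOf`, #S16 r2 `HasCentralType ∕ CentralTypeIs`).  The cited sentence
`Prop413` of the dictionary is [Liu21, Prop. 4.13] — «`H¹_{B,τ'}(A_∞, ℂ) ≅ ⊕_{(μ,ε,χ)} ω(μ,ε,χ)` over ALL adèlic oscillator triples with `μ`
OF WEIGHT ONE and `ε` `μ`-admissible» — ONLY IF the recipe lists exactly Liu's weight-one splittings; any other table makes `hcite` a false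
hypothesis about the honest tower `H = colim_K H¹(X_K(ℂ); ℂ)` and the E term vacuous (binder-2-g20 «ATqI» caveat, HANDOFF-g20 §0d∕§0f).

THE TABLE (this file's one `def`): with `w₁ := (cmPlaceOver L (cmPlace L ι₁)).1` the complex place of `ι₁` (theta-3's literal place term of
#S19 §4) and `Φ^δ(q) := SignRecipe.lineType (scalar ρ q)` the CM type of the line class (binder-2 #94∕#96; = the dictionary's `PhiMu`, #97),

  `muLiu ι₁ ρ q := −𝟙_{w₁}` if `ι₁ ∈ Φ^δ(q)`,   `muLiu ι₁ ρ q := +𝟙_{w₁}` if `ι₁ ∉ Φ^δ(q)`,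

i.e. central exponent `0` at every complex place `w ≠ w₁` and `∓1` at `w₁`.

WHY THIS IS LIU'S «WEIGHT ONE» (N-i1-match; the derivation is `pub-hodgecm-own-htheta/MU0-TABLE.md`, nothing of it is used in the kernel):
[Liu21, App. D Steps 1–3 + Lem. D.2] with [KonnoKonno2007, Lem. 5.2] (vendored reading `kk07Reading`: vacuum exponents
`e_P = (m + ε(q′−p′))∕2`, `e_Q = (m + ε(p′−q′))∕2` on `U(V⁺) × U(V⁻)`): for `μ` of weight one with `ε` `μ`-admissible the parameters `(m, ±)`
are MATCHED at every place; at a `V`-definite place Lem. D.2 (1) says `ω(μ_v, ε_v, χ₀)` is the trivial character, so the Fock vacuum is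
`U(3)`-invariant and its central exponent is `3·e = 0`; at the place of `τ' = ι₁` (signature `(2,1)`) Lem. D.2 (2) gives `(m,±) = (−1,−)` for
`τ' ∈ Φ_μ` (the `H^{1,0}` summands) resp. `(1,+)` for `τ' ∉ Φ_μ` (the `H^{0,1}` summands), whence `(e_P, e_Q) = (0, −1)` resp. `(0, 1)` and
central exponent `2·e_P + 1·e_Q = ∓1`.  Conversely the central type DETERMINES the vacuum exponents (the tree pins `e_P − e_Q` at `w₁`,
`placeVacExponents_eP_sub_eQ`, and a definite place has one block), so «central type `= muLiu q`» cuts out exactly the weight-one `ι_μ` with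
`Φ_μ = Φ^δ(q)`.  In particular the table is NOT constant: over a class with `ι₁ ∉ Φ^δ(q)` no compatible splitting has central type `−𝟙_{w₁}`
(there `2e_P + e_Q ≡ 1 (mod 3)`), so the constant table `−𝟙_{w₁}` would index none of Liu's `H^{0,1}` summands and `Prop413` at the pin
would be false.

KERNEL CONTENT (all `[folklore]`): `muLiu` is a CLASS function (`muLiu_mk`: its value at `mk a` reads `Φ^δ(a)` for any section `ρ` of `mk`,
by #96 `lineType_mul_conj_mul_eq`); `muLiu_mk_of_mem ∕ _of_not_mem`; at every slot line of a good context of the bit of record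
`muLiu ι₁ ρ ⟦a_i⟧ = −𝟙_{w₁}` (`muLiu_mk_slot`, binder-2 #94 `GoodCtx.self_mem_lineType`); and the junction's `hμ` DISCHARGED under carch's
centre identity (CC): `muLiu ι₁ ρ ⟦a⟧ = centralTypeOfTwist V a hGR (bigCharOfV c_V) _` (`muLiu_mk_eq_centralTypeOfTwist_of_CC`, theta-3 #S19
`centralTypeOfTwist_bigCharOfV_of_CC`) with the pointed index corollary `I.exists_line_eq_twistBy_bigCharOfV_muLiu` (#S19
`I.exists_line_eq_twistBy_bigCharOfV_of_CC` at `μ := muLiu ι₁ ρ`).  At the pin of record R2 the (CC_k) are carch #CA72∕#CA73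
`SInstance.lineCharV_k_center_mul_lineC_ROGT'C`, hypothesis-free under `GOG`.
-/

noncomputable section

open NumberField NumberField.InfinitePlace NumberField.mixedEmbedding
open scoped Matrix Classical
open Literature.NumberTheory.Automorphic Literature.NumberTheory.Automorphic.UnitaryGroup Literature.NumberTheory.Weil1964
open Literature.NumberTheory.GelbartRogawski1991 Literature.NumberTheory.GelbartRogawski1991.UnitaryDualPair
open Literature.AlgebraicGeometry.ShimuraVarieties (conjRingHomK)

namespace HodgeCM.Model

open HodgeCM.Model.ArchSideTerm (e₁ infUnitToOne)
open HodgeCM.SignRecipe (lineType)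

namespace LiuIndex

variable {L : CMField} (ι₁ : (L : Type) →+* ℂ) (ρ : GramClass L → RealScalar L)

/-! ## §1 The table -/

/-- **the indicator of the place of `ι₁`**: `𝟙_{w₁}`, `w₁ := (cmPlaceOver L (cmPlace L ι₁)).1` (theta-3's literal place term, #S19 §4). [folklore] -/
abbrev placeIndicator : InfinitePlace (L : Type) → ℤ :=
  Pi.single (cmPlaceOver (L : Type) (HypCensus.cmPlace (L : Type) ι₁)).1 1

/-- **LIU'S WEIGHT-ONE TABLE** (the recipe of record for «ATqI»'s `μ₀`): over the Gram class `q` the archimedean central type (on the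
Gaussian of the pair `(V, ⟨q⟩)`) of the splittings `ι_μ`, `μ` conjugate-symplectic OF WEIGHT ONE with `Φ_μ = Φ^δ(q)` [Liu21, Def. 4.2 ∕ 4.12,
App. D Lem. D.2]: exponent `0` at every place `≠ w₁` and `−1` (resp. `+1`) at `w₁` according as `ι₁ ∈ Φ^δ(q)` (the `H^{1,0}` summands of
Prop. 4.13) or not (the `H^{0,1}` summands).  A DEFINITION (integer data); the literature match is MODEL-N row N-i1-match. [folklore] -/
def muLiu (q : GramClass L) : InfinitePlace (L : Type) → ℤ :=
  if ι₁ ∈ (lineType (GramClass.scalar ρ q) (GramClass.conj_scalar ρ q) (GramClass.scalar_ne ρ q)).1 then -placeIndicator ι₁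
  else placeIndicator ι₁

variable {ι₁ ρ}

/-- (Ported verbatim from the HodgeCMPerL package; no docstring in the source.) -/
theorem muLiu_of_mem {q : GramClass L}
    (h : ι₁ ∈ (lineType (GramClass.scalar ρ q) (GramClass.conj_scalar ρ q) (GramClass.scalar_ne ρ q)).1) :
    muLiu ι₁ ρ q = -placeIndicator ι₁ :=
  if_pos h

/-- (Ported verbatim from the HodgeCMPerL package; no docstring in the source.) -/
theorem muLiu_of_not_mem {q : GramClass L}
    (h : ι₁ ∉ (lineType (GramClass.scalar ρ q) (GramClass.conj_scalar ρ q) (GramClass.scalar_ne ρ q)).1) :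
    muLiu ι₁ ρ q = placeIndicator ι₁ :=
  if_neg h

/-- the table takes exactly the two values `∓𝟙_{w₁}`; away from `w₁` it is `0`. [folklore] -/
theorem muLiu_apply_of_ne (q : GramClass L) {w : InfinitePlace (L : Type)}
    (hw : w ≠ (cmPlaceOver (L : Type) (HypCensus.cmPlace (L : Type) ι₁)).1) : muLiu ι₁ ρ q w = 0 := by
  unfold muLiu
  split_ifs <;> simp [Pi.single_eq_of_ne hw]

/-! ## §2 `muLiu` is a class function: its value at `mk a` reads `Φ^δ(a)` -/

/-- for a section `ρ` of `mk`, the line type of `scalar ρ (mk a)` is `Φ^δ(a)` (the representative is isometric to `a`; #96). [folklore] -/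
theorem lineType_scalar_mk (hρ : ∀ q, GramClass.mk (ρ q) = q) (a : RealScalar L) :
    lineType (GramClass.scalar ρ (GramClass.mk a)) (GramClass.conj_scalar ρ _) (GramClass.scalar_ne ρ _) =
      lineType a.1 a.2.1 a.2.2 := by
  obtain ⟨z, hz, h⟩ := (RealScalar.equiv_iff _ _).1 (GramClass.mk_comp_equiv ρ hρ a).symm
  exact SignRecipe.lineType_eq_of_isometric hz a.2.1 a.2.2 _ _ h

/-- **`muLiu` at a class `mk a`** reads the type of ANY representative. [folklore] -/
theorem muLiu_mk (hρ : ∀ q, GramClass.mk (ρ q) = q) (a : RealScalar L) :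
    muLiu ι₁ ρ (GramClass.mk a) = if ι₁ ∈ (lineType a.1 a.2.1 a.2.2).1 then -placeIndicator ι₁ else placeIndicator ι₁ := by
  unfold muLiu
  rw [lineType_scalar_mk hρ a]

/-- (Ported verbatim from the HodgeCMPerL package; no docstring in the source.) -/
theorem muLiu_mk_of_mem (hρ : ∀ q, GramClass.mk (ρ q) = q) (a : RealScalar L) (h : ι₁ ∈ (lineType a.1 a.2.1 a.2.2).1) :
    muLiu ι₁ ρ (GramClass.mk a) = -placeIndicator ι₁ := by
  rw [muLiu_mk hρ a, if_pos h]

/-- (Ported verbatim from the HodgeCMPerL package; no docstring in the source.) -/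
theorem muLiu_mk_of_not_mem (hρ : ∀ q, GramClass.mk (ρ q) = q) (a : RealScalar L) (h : ι₁ ∉ (lineType a.1 a.2.1 a.2.2).1) :
    muLiu ι₁ ρ (GramClass.mk a) = placeIndicator ι₁ := by
  rw [muLiu_mk hρ a, if_neg h]

/-- **at the four slot lines of a good context of the bit of record the table reads `−𝟙_{w₁}`** (`ι₁ ∈ Φ^δ(a_i)`: binder-2 #94
`GoodCtx.self_mem_lineType`). [folklore] -/
theorem muLiu_mk_slot (hρ : ∀ q, GramClass.mk (ρ q) = q) {c : SeesawCtx L} (hrec : SignRecipe.GoodCtx (Model.orientBitι L ι₁) ι₁ c)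
    (i : Fin 4) :
    muLiu ι₁ ρ (GramClass.mk ⟨c.D.a i, c.D.a_real i, c.D.a_ne i⟩) = -placeIndicator ι₁ :=
  muLiu_mk_of_mem hρ _ (SignRecipe.GoodCtx.self_mem_lineType hrec i)

/-! ## §3 The junction's `hμ` under carch's centre identity (CC) -/

variable (V : HermSpace3 L ι₁)

/-- **`hμ` DISCHARGED under (CC)**: for a `bigCharOfV c_V`-twisted record of record at a scalar `a` with `ι₁ ∈ Φ^δ(a)`, carch's identity
`c_V(u_t · 1_V) · lineC … hGR t = 1` makes the twisted central type EQUAL the table value: `muLiu ι₁ ρ ⟦a⟧ = centralTypeOfTwist …`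
(theta-3 #S19 `centralTypeOfTwist_bigCharOfV_of_CC`). [folklore] -/
theorem muLiu_mk_eq_centralTypeOfTwist_of_CC (hρ : ∀ q, GramClass.mk (ρ q) = q) (a : RealScalar L)
    (ha : ι₁ ∈ (lineType a.1 a.2.1 a.2.2).1)
    (hGR : (cmSplittingDatum (L : Type) e₁ (frameD V) (frameD_real V) (frameD_ne V) (RealScalar.vec a) (RealScalar.vec_real a)
      (RealScalar.vec_ne a)).CompatibleSplitting)
    (hJW : (Matrix.diagonal (RealScalar.vec a)) default default ≠ 0)
    (cV : ↥(UnitaryGroup.adelic (↥(maximalRealSubfield (L : Type))) (L : Type) (IsCMField.complexConj (L : Type)) 3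
        (Matrix.diagonal (frameD V))) →* ℂˣ)
    (hcV : Continuous fun v => ((cV v : ℂˣ) : ℂ))
    (hCC : ∀ t, ((cV (CMCenter (L : Type) (frameD V) (infUnitToOne (L : Type) t)) : ℂˣ) : ℂ) *
      HodgeCM.Model.ArchSideTerm.lineC V a.1 a.2.1 a.2.2 hGR t = 1)
    (h : Continuous
      (twistInf V a
        (HodgeCM.LinePair.bigCharOfV (↥(maximalRealSubfield (L : Type))) (L : Type) (IsCMField.complexConj (L : Type)) 3
          (Matrix.diagonal (frameD V)) (Matrix.diagonal (RealScalar.vec a)) hJW cV))) :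
    muLiu ι₁ ρ (GramClass.mk a) =
      centralTypeOfTwist V a hGR
        (HodgeCM.LinePair.bigCharOfV (↥(maximalRealSubfield (L : Type))) (L : Type) (IsCMField.complexConj (L : Type)) 3
          (Matrix.diagonal (frameD V)) (Matrix.diagonal (RealScalar.vec a)) hJW cV) h := by
  rw [muLiu_mk_of_mem hρ a ha, centralTypeOfTwist_bigCharOfV_of_CC V a hGR hJW cV hcV hCC h]

/-- **the junction's `hμ` in binder-2's SPLIT currency, from (CC) ALONE** (no twist record, no `bigCharOfV`): for ANY continuous
`V`-character `c_V` with `c_V(u_t · 1_V) · lineC … hGR t = 1`, `charArchType (c_V ∘ centre_∞) + centralTypeOf V a hGR = −𝟙_{w₁}`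
(`lineC = lineCenterChar · ι_{w₁}`, `ArchSideTerm.lineC_def`; types add, `charArchType_mul'`). [folklore] -/
theorem charArchType_centerCharInf_add_centralTypeOf_of_CC (a : RealScalar L)
    (hGR : (cmSplittingDatum (L : Type) e₁ (frameD V) (frameD_real V) (frameD_ne V) (RealScalar.vec a) (RealScalar.vec_real a)
      (RealScalar.vec_ne a)).CompatibleSplitting)
    (cV : ↥(UnitaryGroup.adelic (↥(maximalRealSubfield (L : Type))) (L : Type) (IsCMField.complexConj (L : Type)) 3
        (Matrix.diagonal (frameD V))) →* ℂˣ)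
    (hcV : Continuous fun v => ((cV v : ℂˣ) : ℂ))
    (hCC : ∀ t, ((cV (CMCenter (L : Type) (frameD V) (infUnitToOne (L : Type) t)) : ℂˣ) : ℂ) *
      HodgeCM.Model.ArchSideTerm.lineC V a.1 a.2.1 a.2.2 hGR t = 1) :
    Literature.NumberTheory.Automorphic.charArchType (L : Type) (centerCharInf V cV) (continuous_centerCharInf V cV hcV) +
        centralTypeOf V a hGR = -placeIndicator ι₁ := by
  rw [centralTypeOf_eq_charArchType_kappaOf,
    ← HodgeCM.Model.ArchSideTerm.charArchType_mul' (L : Type) _ _ (continuous_centerCharInf V cV hcV) (continuous_kappaOf V a hGR)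
      ((continuous_centerCharInf V cV hcV).mul (continuous_kappaOf V a hGR)),
    Literature.NumberTheory.Automorphic.charArchType_eq_iff]
  ext t
  rw [Literature.NumberTheory.Automorphic.archWeight_neg, archWeight_single_zpow, zpow_one, MonoidHom.mul_apply, centerCharInf_apply]
  have hc := hCC t
  rw [HodgeCM.Model.ArchSideTerm.lineC_def, ← mul_assoc] at hc
  exact (eq_inv_of_mul_eq_one_left hc).symm

/-- **`hμ` at the recipe of record in the SPLIT currency**: `muLiu ι₁ ρ ⟦a⟧ = charArchType (c_V ∘ centre_∞) + centralTypeOf V a hGR` under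
(CC) and `ι₁ ∈ Φ^δ(a)` — binder-2's `hμ` of `hJ_slot_k` (`JLiuSlots`) at `μ := muLiu ι₁ ρ`, `c_V := adelicChar_k …`. [folklore] -/
theorem muLiu_mk_eq_add_of_CC (hρ : ∀ q, GramClass.mk (ρ q) = q) (a : RealScalar L)
    (ha : ι₁ ∈ (lineType a.1 a.2.1 a.2.2).1)
    (hGR : (cmSplittingDatum (L : Type) e₁ (frameD V) (frameD_real V) (frameD_ne V) (RealScalar.vec a) (RealScalar.vec_real a)
      (RealScalar.vec_ne a)).CompatibleSplitting)
    (cV : ↥(UnitaryGroup.adelic (↥(maximalRealSubfield (L : Type))) (L : Type) (IsCMField.complexConj (L : Type)) 3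
        (Matrix.diagonal (frameD V))) →* ℂˣ)
    (hcV : Continuous fun v => ((cV v : ℂˣ) : ℂ))
    (hCC : ∀ t, ((cV (CMCenter (L : Type) (frameD V) (infUnitToOne (L : Type) t)) : ℂˣ) : ℂ) *
      HodgeCM.Model.ArchSideTerm.lineC V a.1 a.2.1 a.2.2 hGR t = 1) :
    muLiu ι₁ ρ (GramClass.mk a) =
      Literature.NumberTheory.Automorphic.charArchType (L : Type) (centerCharInf V cV) (continuous_centerCharInf V cV hcV) +
        centralTypeOf V a hGR := by
  rw [muLiu_mk_of_mem hρ a ha, charArchType_centerCharInf_add_centralTypeOf_of_CC V a hGR cV hcV hCC]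

/-- **the pointed index corollary at the recipe of record**: under (CC), `ρ q = a` and `ι₁ ∈ Φ^δ(a)`, there is an index `j : I V ρ (muLiu ι₁ ρ)`
over `q` whose line IS the `bigCharOfV c_V`-twisted record of record (#S19 `I.exists_line_eq_twistBy_bigCharOfV_of_CC` at `μ := muLiu ι₁ ρ`). [folklore] -/
theorem I.exists_line_eq_twistBy_bigCharOfV_muLiu (hρ : ∀ q, GramClass.mk (ρ q) = q) {q : GramClass L} {a : RealScalar L}
    (hq : ρ q = a) (ha : ι₁ ∈ (lineType a.1 a.2.1 a.2.2).1)
    (hGR : (cmSplittingDatum (L : Type) e₁ (frameD V) (frameD_real V) (frameD_ne V) (RealScalar.vec a) (RealScalar.vec_real a)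
      (RealScalar.vec_ne a)).CompatibleSplitting)
    (hJW : (Matrix.diagonal (RealScalar.vec a)) default default ≠ 0)
    (cV : ↥(UnitaryGroup.adelic (↥(maximalRealSubfield (L : Type))) (L : Type) (IsCMField.complexConj (L : Type)) 3
        (Matrix.diagonal (frameD V))) →* ℂˣ)
    (hcV : Continuous fun v => ((cV v : ℂˣ) : ℂ))
    (hCC : ∀ t, ((cV (CMCenter (L : Type) (frameD V) (infUnitToOne (L : Type) t)) : ℂˣ) : ℂ) *
      HodgeCM.Model.ArchSideTerm.lineC V a.1 a.2.1 a.2.2 hGR t = 1)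
    (hĉ : (SplitLineE.ofCMOf V e₁ (RealScalar.vec a) (RealScalar.vec_real a) (RealScalar.vec_ne a) hGR).IsRatTrivial
      (HodgeCM.LinePair.bigCharOfV (↥(maximalRealSubfield (L : Type))) (L : Type) (IsCMField.complexConj (L : Type)) 3
        (Matrix.diagonal (frameD V)) (Matrix.diagonal (RealScalar.vec a)) hJW cV)) :
    ∃ j : I V ρ (muLiu ι₁ ρ), j.1 = q ∧
      line V ρ (muLiu ι₁ ρ) j =
        (SplitLineE.ofCMOf V e₁ (RealScalar.vec a) (RealScalar.vec_real a) (RealScalar.vec_ne a) hGR).twistBy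
          (HodgeCM.LinePair.bigCharOfV (↥(maximalRealSubfield (L : Type))) (L : Type) (IsCMField.complexConj (L : Type)) 3
            (Matrix.diagonal (frameD V)) (Matrix.diagonal (RealScalar.vec a)) hJW cV) hĉ := by
  exact I.exists_line_eq_twistBy_bigCharOfV_of_CC V (muLiu ι₁ ρ) hq hGR hJW cV hcV hCC hĉ (muLiu_mk_of_mem hρ a ha)

end LiuIndex

end HodgeCM.Model

end
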